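import Mathlib
import Summits.Ventures.HodgeRepro.Tier4.Line1.RTFSetting
import Summits.Ventures.HodgeRepro.Tier4.Line1.HeckeIsolation
import Summits.Ventures.HodgeRepro.Tier4.Line1.HeckeIsolationHecke
import Summits.Ventures.HodgeRepro.Tier4.Line1.HeckeBlockWeak
import Summits.Ventures.HodgeRepro.Tier4.Line1.HeckeBlockIdempotent
import Summits.Ventures.HodgeRepro.Tier4.Line1.HeckeIsolationSpherical

/-!
# Tier4/Line1/HeckeIsolationIdempotent — (S3″) end to end from a family of IDEMPOTENT blocks (trivial type `indK`
or the σ-isotypic `eσ` of (S3σ) alike)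

Blind re-derivation cell `pub-hodge-repro`, Tier 4 (README §9–§10), seat t4-L1-p5 (prover, LINE L1, gen 3).  Target tree
path `lean/Summits/Ventures/HodgeRepro/Tier4/Line1/HeckeIsolationIdempotent.lean`.  Imports this seat's
`HeckeBlockIdempotent` (p689660: `IdempotentData`, `IdempotentData.toHeckeBlockW`) and `HeckeIsolationSpherical`
(p687844: `isolationRealised_of_heckeBlockW`).

WHAT THIS IS.  `isolationRealised_of_idempotentData`: p1's (S3″) `IsolationRealised` from ONE `IdempotentData` per
constituent carrying both toric periods (common Hecke algebra `H`, common `tst`), the test-vector clauses on the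
blocks and the dictionary `RealisedHecke` — the composition of `IdempotentData.toHeckeBlockW` with
`isolationRealised_of_heckeBlockW`.  On the instance the family is `IdempotentData.ofIsotypic` (t4-L1-p3 g3's
(S3σ), `Tier4/Line1/IsotypicInstance`) for the corner forms' type σ, or the spherical data for the trivial type; in
both the idempotent identities and fact (A) are kernel theorems, and the display is: the `H`-module structure of the
fixed block (`hact`), the Hecke property `f ⋆ e = f`, the projections, (C1), (C2), the test-vector clauses, the
dictionary.  Nothing of them is proved.  Nothing here says anything about the status of the Hodge conjecture for CM
abelian varieties, which is NOT proved (HC_CM is NOT proved by anyone in this repository).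
-/

set_option autoImplicit false

noncomputable section

namespace Summit.Ventures.HodgeRepro.Tier4.Line1

open MeasureTheory Topology NumberField Common PeriodCloser

section Idempotent

variable {Form : Type} [AddCommGroup Form] [Module ℂ Form] {A : FormAlgebra Form} {W : Witness A}
  {G : Type} [Group G] [TopologicalSpace G] [IsTopologicalGroup G] [MeasurableSpace G] [BorelSpace G]
  (S : RTF.Setting G) (χ : S.T → ℂ) (χ' : S.T' → ℂ) (τ : ℕ → Set (G → ℂ)) (Lift : ℕ → Prop)
  (φ : ℕ → G → ℂ) (n : ℕ → ℕ) (tf : W.Translates → (G → ℂ) × (G → ℂ)) (H : Type) (tst : H → (G → ℂ))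

/-- **(S3″) from a family of IDEMPOTENT Hecke blocks**, asked only at the constituents carrying both toric periods:
`IsolationRealised` from `IdempotentData` at those constituents (common Hecke algebra `H`, common `tst`), the
test-vector clauses on the fixed blocks and the dictionary `RealisedHecke`.  `Lift` is not used. -/
theorem isolationRealised_of_idempotentData [Countable S.Gk] [MeasurableMul G] [SecondCountableTopology G]
    [T2Space G] [SFinite S.μ] [Ring H] [Algebra ℂ H]
    (hB : S.IsAdaptedONB τ φ n) (ι : ℕ → Type) [∀ m, Fintype (ι m)] [∀ m, DecidableEq (ι m)]
    (Vb : ℕ → Submodule ℂ (G → ℂ)) [∀ m, FiniteDimensional ℂ (Vb m)] [∀ m, Module H (Vb m)]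
    [∀ m, IsScalarTower ℂ H (Vb m)]
    (D : ∀ m, S.PeriodNonzeroT χ (τ m) → S.PeriodNonzeroT' χ' (τ m) →
      RTF.Setting.IdempotentData S τ m H (ι m) (Vb m))
    (htst : ∀ m hT hT', (D m hT hT').tst = tst)
    (hPA : ∀ m, S.PeriodNonzeroT χ (τ m) →
      ∃ w ∈ RTF.Setting.blockAdmissible τ m (Vb m), S.periodT χ (fun t => w t) ≠ 0)
    (hPA' : ∀ m, S.PeriodNonzeroT' χ' (τ m) →
      ∃ w' ∈ RTF.Setting.blockAdmissible τ m (Vb m), S.periodT' χ' (fun t' => w' t') ≠ 0)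
    (hreal : RealisedHecke S χ χ' φ n tf H tst) : IsolationRealised S χ χ' τ Lift φ n tf :=
  isolationRealised_of_heckeBlockW S χ χ' τ Lift φ n tf H tst hB ι Vb
    (fun m hT hT' => (D m hT hT').toHeckeBlockW hB.inv) (fun m hT hT' => htst m hT hT') hPA hPA' hreal

end Idempotent

end Summit.Ventures.HodgeRepro.Tier4.Line1

end
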